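import Summits.BirchSwinnertonDyer.BirchSwinnertonDyer.Theorems.QuadraticBranchSignedControlPlusEtaNonsurjConjADoorUpper
import Literature.NumberTheory.NumberFields.ClassGroupExtension
import HarnessLib

/-!
# Route `QuadraticBranchSignedControl` (rung K8, cell `bsd-potss`), residual crux `PlusEtaMainConjectureNonsurj`
# (stmt-BirchSwinnertonDyer-19606): DOOR L6⁻ — statement (A) from the RELATIVE class number of `ℚ(P) ⊃ ℚ(x(P))`
# (seat `bsd-potss-k8eta-c2` g21, sequel of `…PlusEtaNonsurjConjADoor` p690512 / `…ConjADoorUpper` p691623)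

WHAT. Door L6 (conjA-anchor g17, `CoatesSujatha2005.conjA_of_eigenHom_subfield`, fact-free) gives statement (A) for `E/ℚ` at an odd `p`
from (c1) `p ∤ #Gal(ℚ(E[p])/ℚ)`, (c3) at `p`, and the TAUTOLOGICAL EIGEN-TEST on ONE torsion-point field `K = ℚ(P)`: every additive
`μ : Cl(𝓞_K) → ℤ/p` with `μ([σ̄ I]) = a • μ([I])` whenever `σ̄ = τ|_K`, `τ • P = a • P`, vanishes (conjA-anchor g13). g20 fed it the
EMPTY case `p ∤ h(ℚ(P))`. THIS FILE proves the next case, which costs one more class number and NO automorphism computation: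

**Door L6⁻.** Let `τ ∈ Γ_ℚ` act as `−1` on `P` (on a row / partner of crux 19606 such a `τ` exists in the inertia at `p`, p690512
`exists_mem_inertia_smul_eq_neg_pair`), `σ = τ|_K ∈ Aut(K/ℚ)` (`K = ℚ(P)` is `τ`-stable), `K⁺ = K^σ` (`= ℚ(x(P))`, `[K : K⁺] = #⟨σ⟩ ∣ 2`).
A tautological eigenfunctional `μ` satisfies `μ([σ I]) = (p − 1) • μ([I]) = −μ([I])`, so it KILLS every `σ`-fixed class, in particular
every extended class `i_{K/K⁺}[𝔟]`. The finite-group lemma of §0 (`N_{K/K⁺} ∘ i_{K/K⁺} = [K:K⁺]` is prime to `p`, so `i` has a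
`p'`-kernel; if moreover `v_p(h_K) ≤ v_p(h_{K⁺})` then `[Cl_K : i(Cl_{K⁺})]` is prime to `p`) forces `μ = 0`. Hence
**`v_p h(ℚ(P)) ≤ v_p h(ℚ(x(P))) ⟹ (c2) ⟹ (A)(W, p)`** — on the rows and partners of crux 19606 with (c1), (c3) discharged by p690512.

* §0 `addMonoidHom_zmod_eq_zero_of_norm_extend` — the finite-group index lemma (Lagrange + Cauchy).
* §1 `tautEigenHom_eq_zero_of_padicValNat_classNumber_le` — number-field form: `K`, `σ ∈ Aut(K/ℚ)` fixing `K⁺ ⊆ K` pointwise,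
  `p ∤ [K:K⁺]`, `v_p(h_K) ≤ v_p(h_{K⁺})`, `(a : ℤ/p) ≠ 1` ⟹ every `μ` with `μ([σI]) = a • μ([I])` is zero (Neukirch III (1.6)(ii) on classes,
  tree `classGroupNorm_classGroupExtend`).
* §2 `exists_algEquiv_stabilizerField_of_smul_eq_neg` — `ℚ(P)` is `τ`-stable when `τ • P = −P`; the induced `σ ∈ Aut(ℚ(P)/ℚ)` has `σ² = 1`.
* §3 `conjA_of_relClassNumber` — curve-generic, FACT-FREE: (A) ⟸ `p` odd, `W[p]` irreducible, (c1), (c3) at `p`, and ONE datum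
  «`∃ P ≠ 0` with an inertial/any `τ`, `τ • P = −P`, and `v_p h(ℚ(P)) ≤ v_p h(ℚ(P)^σ)`».
* §4 `conjA_row_of_relClassNumber`, `conjA_partner_of_relClassNumber` — on the rows / partners of crux 19606 ((c1), (c3), `τ` automatic).
* (sequel file `…ConjADoorMinusUpper`) door L6⁻ ∘ g6's fine road BY NAME (as in p691623): the integral Kato inclusion at `η`, (C1⁺_η) on
  the prime-`L` rank-1 shape, the rank-0 and CM rank-0 shapes, from the relative class-number datum.

SCOPE (numbers, not adjectives; census k8eta-c2 g21 kit j326603/j326606/j326613, GRH class numbers). Re-reading g20's QP5 census at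
`p = 5` through this door decides 5 of its 33 undecided in-table partner rows (260100e1, 326700fg1, 326700y1, 357075br1 — CM rank 1 —,
378225bk1 — CM rank 0) and 7 of the 8 resolved members of the UNCONGRUENT family u5a (`X_ns⁺(5)`, `t = 4/5`; `D = −4, −8, 8, 13, −19, 37,
−43`; `h(ℚ(x(P))) = 15` is `D`-invariant), the domain of v7's hardest stub `stub_etaMC_nonCM_uncongruent`, where the plain class-number
door is void family-wide. It is CONSISTENT on the 28 rows with a `Sel₀`-source (all have `v_5 h(ℚ(P)) > v_5 h(ℚ(x(P)))`): the classes
produced by `Sel₀(ℚ, W[p])` live in the `σ = −1` part. NOT a candidate stub (void whenever `Sel₀(ℚ, W[p]) ≠ 0`): a PER-ROW road.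

HONEST FRAMING (cell `bsd-potss`; FULL-BSD rank ≤ 1 programme, HUMAN RULING D-0036/D-0074): TOOL THEOREMS ONLY — no definition, no named
fact, no `sorry`, axioms standard. The class numbers stay displayed (GRH numerics are evidence, never facts). No stub of 19606 is proved
by name; the crux stays OPEN; nothing is booked; (A) and `BSD(W,p)` are claimed for no pair. `--supports stmt-BirchSwinnertonDyer-19606 --as helper`.

References: [CoatesSujatha2005] §3 Conjecture A, Thm. 3.4, Lemma 3.8; [DeoRaySujatha2023] Thm. 3.8 (c1)–(c3) (arXiv:2202.09937 p. 9);
[NeukirchANT1999] Ch. III §1 Prop. (1.6) (ii), (iv); Ch. I §3; [Washington1997] §10.1 (extension/norm on class groups);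
[Serre1972] §1.11 Prop. 12; [SilvermanAEC2009] X.5 Cor. 5.4.
-/

set_option autoImplicit false
set_option linter.dupNamespace false
noncomputable section

open scoped Classical

open NumberField IsDedekindDomain Field WeierstrassCurve
open Literature.NumberTheory.EllipticCurves Literature.NumberTheory.GaloisRepresentations
  Literature.NumberTheory.EllipticCurves.Rank1Residual Literature.NumberTheory.NumberFields Rat.HeightOneSpectrum
open Literature.NumberTheory.EllipticCurves.GreenbergSelmer (decomp)
open Literature.NumberTheory.EllipticCurves.CoatesSujatha2005
open Summit.BirchSwinnertonDyer.Rank1Residual Summit.BirchSwinnertonDyer.Rank1Residual.GaloisImage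
open scoped nonZeroDivisors

namespace Summit.BirchSwinnertonDyer.BirchSwinnertonDyer.Theorems.EtaConjADoorMinus

variable (p : ℕ) [hp : Fact p.Prime]

/-! ## §0 A finite-group index lemma -/

/-- **Index lemma.** `i : B → A`, `N : A → B` homomorphisms of finite abelian groups with `N (i b) = b ^ d`, `p ∤ d`, and
`v_p(#A) ≤ v_p(#B)`: then every additive `μ : A → ℤ/p` vanishing on `i(B)` is zero. (The kernel of `i` is killed by `d`, so by
Cauchy it has order prime to `p`; hence `v_p #i(B) = v_p #B ≥ v_p #A`, the index `[A : i(B)]` is prime to `p` (Lagrange), and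
`[A : i(B)] • μ(x) = μ(x^{[A:i(B)]}) = 0`.) [folklore] -/
theorem addMonoidHom_zmod_eq_zero_of_norm_extend {A B : Type*} [CommGroup A] [CommGroup B] [Finite A] [Finite B]
    {d : ℕ} (hd : ¬ p ∣ d) (i : B →* A) (N : A →* B) (hNi : ∀ b, N (i b) = b ^ d)
    (hcard : padicValNat p (Nat.card A) ≤ padicValNat p (Nat.card B))
    (μ : Additive A →+ ZMod p) (hμ : ∀ b, μ (Additive.ofMul (i b)) = 0) : μ = 0 := by
  have hpp : p.Prime := hp.out
  -- the kernel of `i` has order prime to `p`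
  have hker : ¬ p ∣ Nat.card i.ker := by
    intro h
    obtain ⟨x, hx⟩ := exists_prime_orderOf_dvd_card' p h
    have hix : i (x : B) = 1 := (MonoidHom.mem_ker).mp x.2
    have hxd : (x : B) ^ d = 1 := by rw [← hNi, hix, map_one]
    have h1 : orderOf (x : B) = p := (orderOf_injective i.ker.subtype i.ker.subtype_injective x).trans hx
    exact hd (h1 ▸ orderOf_dvd_of_pow_eq_one hxd)
  -- `#B = #i(B) · #ker i` and `#A = [A : i(B)] · #i(B)`
  have hB : Nat.card B = Nat.card i.range * Nat.card i.ker := by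
    rw [← Subgroup.index_ker, Subgroup.index_mul_card]
  have hA : i.range.index * Nat.card i.range = Nat.card A := Subgroup.index_mul_card i.range
  have hA0 : Nat.card A ≠ 0 := Nat.card_pos.ne'
  have hR0 : Nat.card i.range ≠ 0 := Nat.card_pos.ne'
  have hK0 : Nat.card i.ker ≠ 0 := Nat.card_pos.ne'
  have hidx0 : i.range.index ≠ 0 := fun h => hA0 (by rw [← hA, h, zero_mul])
  have hv1 : padicValNat p (Nat.card A) = padicValNat p i.range.index + padicValNat p (Nat.card i.range) := by
    rw [← hA, padicValNat.mul hidx0 hR0]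
  have hv2 : padicValNat p (Nat.card B) = padicValNat p (Nat.card i.range) := by
    rw [hB, padicValNat.mul hR0 hK0, padicValNat.eq_zero_of_not_dvd hker, add_zero]
  have hv : padicValNat p i.range.index = 0 := by
    rw [hv1, hv2] at hcard
    omega
  have hpi : ¬ p ∣ i.range.index := by
    rcases padicValNat.eq_zero_iff.mp hv with h | h | h
    · exact absurd h hpp.one_lt.ne'
    · exact absurd h hidx0
    · exact h
  -- conclude: `[A : i(B)] • μ x = μ (x ^ [A : i(B)]) = 0`
  refine AddMonoidHom.ext fun x => ?_
  have hmem : (Additive.toMul x) ^ i.range.index ∈ i.range := Subgroup.pow_index_mem _ _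
  obtain ⟨b, hb⟩ := MonoidHom.mem_range.mp hmem
  have h0 : μ (i.range.index • x) = 0 := by
    have : i.range.index • x = Additive.ofMul (i b) := by
      rw [hb, ofMul_pow, ofMul_toMul]
    rw [this, hμ]
  have h1 : ((i.range.index : ℕ) : ZMod p) * μ x = 0 := by rw [← nsmul_eq_mul, ← map_nsmul, h0]
  have hunit : IsUnit ((i.range.index : ℕ) : ZMod p) := by
    rw [ZMod.isUnit_iff_coprime]
    exact Nat.coprime_comm.mp ((Nat.Prime.coprime_iff_not_dvd hpp).mpr hpi)
  rw [AddMonoidHom.zero_apply]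
  exact (hunit.mul_right_eq_zero).mp h1

/-! ## §1 Number-field form: tautological eigenfunctionals die when `v_p(h_K) ≤ v_p(h_{K⁺})` -/

/-- **Door L6⁻, number-field form.** `K` a number field, `σ ∈ Aut(K/ℚ)`, `K⁺ ⊆ K` a subfield fixed pointwise by `σ`, `p ∤ [K : K⁺]`,
`v_p(h_K) ≤ v_p(h_{K⁺})`, `a ∈ ℕ` with `a ≢ 1 (mod p)`. Then every additive `μ : Cl(𝓞_K) → ℤ/p` with `μ([σ I]) = a • μ([I])` for all
integral ideals `I` is zero: `μ` kills the `σ`-fixed extended classes `i_{K/K⁺}[𝔟]` (`(1 − a) μ = 0` there), and §0 applies with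
`N_{K/K⁺}(i_{K/K⁺} c) = c^{[K:K⁺]}`. [cite: NeukirchANT1999, Ch. III §1 Prop. (1.6) (ii)] [cite: Washington1997, §10.1] -/
theorem tautEigenHom_eq_zero_of_padicValNat_classNumber_le
    (K : Type) [Field K] [NumberField K] (σ : K ≃ₐ[ℚ] K) (Kp : IntermediateField ℚ K)
    (hfix : ∀ x : Kp, σ (x : K) = x) (hd : ¬ p ∣ Module.finrank Kp K)
    (hh : padicValNat p (NumberField.classNumber K) ≤ padicValNat p (NumberField.classNumber Kp))
    (a : ℕ) (ha : ((a : ℕ) : ZMod p) ≠ 1)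
    (μ : Additive (ClassGroup (𝓞 K)) →+ ZMod p)
    (hμ : ∀ I J : (Ideal (𝓞 K))⁰,
      (J : Ideal (𝓞 K)) = (I : Ideal (𝓞 K)).map (AmbiguousClass.intAut σ : 𝓞 K →+* 𝓞 K) →
      μ (Additive.ofMul (ClassGroup.mk0 J)) = a • μ (Additive.ofMul (ClassGroup.mk0 I))) :
    μ = 0 := by
  -- `μ` kills the extended classes
  have hkill : ∀ b : ClassGroup (𝓞 Kp), μ (Additive.ofMul (classGroupExtend Kp K b)) = 0 := by
    intro b
    obtain ⟨I, rfl⟩ := ClassGroup.mk0_surjective b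
    rw [classGroupExtend_mk0]
    have hI'mem : (I : Ideal (𝓞 Kp)).map (algebraMap (𝓞 Kp) (𝓞 K)) ∈ (Ideal (𝓞 K))⁰ := by
      refine mem_nonZeroDivisors_of_ne_zero fun h => nonZeroDivisors.coe_ne_zero I ?_
      exact (Ideal.map_eq_bot_iff_of_injective (FaithfulSMul.algebraMap_injective (𝓞 Kp) (𝓞 K))).mp h
    set I' : (Ideal (𝓞 K))⁰ := ⟨(I : Ideal (𝓞 Kp)).map (algebraMap (𝓞 Kp) (𝓞 K)), hI'mem⟩ with hI'
    -- `σ I' = I'` since `σ` fixes `K⁺` pointwise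
    have hfixI : (I' : Ideal (𝓞 K)) = (I' : Ideal (𝓞 K)).map (AmbiguousClass.intAut σ : 𝓞 K →+* 𝓞 K) := by
      change (I : Ideal (𝓞 Kp)).map (algebraMap (𝓞 Kp) (𝓞 K)) =
        ((I : Ideal (𝓞 Kp)).map (algebraMap (𝓞 Kp) (𝓞 K))).map (AmbiguousClass.intAut σ : 𝓞 K →+* 𝓞 K)
      rw [Ideal.map_map]
      congr 1
      refine RingHom.ext fun x => RingOfIntegers.ext ?_
      change ((algebraMap (𝓞 Kp) (𝓞 K) x : 𝓞 K) : K) = σ (((algebraMap (𝓞 Kp) (𝓞 K) x : 𝓞 K) : K))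
      exact (hfix (x : Kp)).symm
    have h1 := hμ I' I' hfixI
    -- `(1 - a) • μ = 0`
    have h2 : ((a : ℕ) : ZMod p) * μ (Additive.ofMul (ClassGroup.mk0 I')) = μ (Additive.ofMul (ClassGroup.mk0 I')) := by
      rw [← nsmul_eq_mul]; exact h1.symm
    have h3 : (((a : ℕ) : ZMod p) - 1) * μ (Additive.ofMul (ClassGroup.mk0 I')) = 0 := by
      rw [sub_mul, one_mul, h2, sub_self]
    rcases mul_eq_zero.mp h3 with h | h
    · exact absurd (sub_eq_zero.mp h) ha
    · exact h
  -- §0 with `i = i_{K/K⁺}`, `N = N_{K/K⁺}`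
  refine addMonoidHom_zmod_eq_zero_of_norm_extend p hd (classGroupExtend Kp K) (classGroupNorm Kp K)
    (classGroupNorm_classGroupExtend Kp K) ?_ μ hkill
  simpa only [Nat.card_eq_fintype_card, NumberField.classNumber] using hh


/-! ## §2 The stabiliser field `ℚ(P)` is stable under any `τ` with `τ • P = −P`; the induced involution -/

omit hp in
/-- **`ℚ(P)` is `τ`-stable and `τ` induces an involution of it.** For `P ∈ W[p]` and `τ ∈ Γ_ℚ` with `τ • P = −P`, the fixed field
`K = ℚ(P)` (inside `ℚ(W[p])`, of the image of the stabiliser of `P`) is mapped into itself by `τ` (`τ⁻¹ g τ` stabilises `P` whenever `g`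
does), so `τ|_K` is an automorphism `σ ∈ Aut(K/ℚ)`; and `σ² = 1` (`τ²` stabilises `P`). [folklore]
[cite: NeukirchANT1999, Ch. IV §1 (Galois correspondence; shape only)] -/
theorem exists_algEquiv_stabilizerField_of_smul_eq_neg (W : WeierstrassCurve ℚ) [W.IsElliptic] [NeZero p]
    (P : geomTorsion W (p : ℤ)) (τ : absoluteGaloisGroup ℚ) (hτ : τ • P = -P)
    (K : IntermediateField ℚ (W.divisionField p))
    (hK : K = IntermediateField.fixedField
      ((MulAction.stabilizer (absoluteGaloisGroup ℚ) P).map (absRestrictNormalHom (W.divisionField p)))) :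
    ∃ σ : K ≃ₐ[ℚ] K,
      (∀ x : K, absRestrictNormalHom (W.divisionField p) τ (x : W.divisionField p) = ((σ x : K) : W.divisionField p)) ∧
      ∀ x : K, σ (σ x) = x := by
  -- `τ⁻¹ • P = -P`
  have hτinv : τ⁻¹ • P = -P := by
    have h1 : τ⁻¹ • (τ • P) = P := inv_smul_smul τ P
    rw [hτ, smul_neg] at h1
    rw [← neg_neg (τ⁻¹ • P), h1]
  -- conjugates of stabiliser elements stabilise `P`
  have hconj : ∀ g ∈ MulAction.stabilizer (absoluteGaloisGroup ℚ) P,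
      τ⁻¹ * g * τ ∈ MulAction.stabilizer (absoluteGaloisGroup ℚ) P := by
    intro g hg
    rw [MulAction.mem_stabilizer_iff] at hg ⊢
    rw [mul_smul, mul_smul, hτ, smul_neg, hg, smul_neg, hτinv, neg_neg]
  have hττ : τ * τ ∈ MulAction.stabilizer (absoluteGaloisGroup ℚ) P := by
    rw [MulAction.mem_stabilizer_iff, mul_smul, hτ, smul_neg, hτ, neg_neg]
  -- elements of the stabiliser fix `K` pointwise
  have hfixK : ∀ g ∈ MulAction.stabilizer (absoluteGaloisGroup ℚ) P, ∀ x : K,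
      absRestrictNormalHom (W.divisionField p) g (x : W.divisionField p) = x := by
    intro g hg x
    have hx : (x : W.divisionField p) ∈ IntermediateField.fixedField
        ((MulAction.stabilizer (absoluteGaloisGroup ℚ) P).map (absRestrictNormalHom (W.divisionField p))) := by
      rw [← hK]; exact x.2
    exact (IntermediateField.mem_fixedField_iff _ (x : W.divisionField p)).mp hx _
      (Subgroup.mem_map_of_mem (absRestrictNormalHom (W.divisionField p)) hg)
  -- `τ` maps `K` into `K`
  have hstab : ∀ x : K, absRestrictNormalHom (W.divisionField p) τ (x : W.divisionField p) ∈ K := by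
    intro x
    refine hK.symm.le ((IntermediateField.mem_fixedField_iff _ _).mpr ?_)
    intro g hg
    obtain ⟨g₀, hg₀, rfl⟩ := Subgroup.mem_map.mp hg
    have h1 : absRestrictNormalHom (W.divisionField p) g₀
          (absRestrictNormalHom (W.divisionField p) τ (x : W.divisionField p)) =
        absRestrictNormalHom (W.divisionField p) (τ * (τ⁻¹ * g₀ * τ)) (x : W.divisionField p) := by
      rw [← AlgEquiv.mul_apply, ← map_mul]
      congr 2
      group
    rw [h1, map_mul, AlgEquiv.mul_apply, hfixK _ (hconj g₀ hg₀) x]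
  -- the induced endomorphism of `K`, bijective since `K/ℚ` is algebraic
  let ψ : K →ₐ[ℚ] K :=
    { toFun := fun x => ⟨absRestrictNormalHom (W.divisionField p) τ (x : W.divisionField p), hstab x⟩
      map_one' := Subtype.ext (by simp)
      map_mul' := fun x y => Subtype.ext (by simp)
      map_zero' := Subtype.ext (by simp)
      map_add' := fun x y => Subtype.ext (by simp)
      commutes' := fun r => Subtype.ext (by simp) }
  have hψ : Function.Bijective ψ := Algebra.IsAlgebraic.algHom_bijective ψ
  refine ⟨AlgEquiv.ofBijective ψ hψ, fun x => rfl, fun x => ?_⟩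
  apply Subtype.ext
  change absRestrictNormalHom (W.divisionField p) τ
      (absRestrictNormalHom (W.divisionField p) τ (x : W.divisionField p)) = (x : W.divisionField p)
  rw [← AlgEquiv.mul_apply, ← map_mul]
  exact hfixK _ hττ x

/-! ## §3 Door L6⁻, curve-generic and fact-free -/

/-- The `p`-torsion point `P` satisfies `(p − 1) • P = −P`. [folklore] -/
theorem pred_nsmul_eq_neg (W : WeierstrassCurve ℚ) [W.IsElliptic] (P : geomTorsion W (p : ℤ)) :
    (p - 1) • P = -P := by
  have hpP : (p : ℕ) • P = 0 := by
    apply Subtype.ext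
    have hv : ((P : geomTorsion W (p : ℤ)) : geomPoints W) ∈ AddSubgroup.torsionBy (geomPoints W) (p : ℤ) := P.2
    rw [AddSubgroup.torsionBy, Submodule.mem_toAddSubgroup, Submodule.mem_torsionBy_iff] at hv
    rw [AddSubgroupClass.coe_nsmul, ZeroMemClass.coe_zero, ← natCast_zsmul]
    exact hv
  have h1 : (p - 1) • P + P = 0 := by
    rw [← succ_nsmul, Nat.sub_add_cancel hp.out.one_le, hpP]
  exact eq_neg_of_add_eq_zero_left h1

/-- `−1 ≢ 1 (mod p)` for an odd prime, in the form `((p − 1 : ℕ) : ZMod p) ≠ 1`. [folklore] -/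
theorem natCast_pred_ne_one (hp2 : p ≠ 2) : ((p - 1 : ℕ) : ZMod p) ≠ 1 := by
  haveI : Fact (2 < p) := ⟨lt_of_le_of_ne hp.out.two_le (Ne.symm hp2)⟩
  rw [Nat.cast_sub hp.out.one_le, Nat.cast_one, ZMod.natCast_self, zero_sub]
  exact ZMod.neg_one_ne_one

/-- **DOOR L6⁻ (relative class number), curve-generic, NO named fact.** `W/ℚ` elliptic, `p` odd, `W[p]` irreducible, (c1)
`p ∤ #Gal(ℚ(W[p])/ℚ)`, (c3) at the places above `p` in the `E[p^∞]`-currency, and ONE datum: a non-zero `P ∈ W[p]` and a `τ ∈ Γ_ℚ` with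
`τ • P = −P` such that, for `K = ℚ(P)` (the fixed field of the image of the stabiliser of `P`) and the involution `σ = τ|_K` of §2,
**`v_p(h(K)) ≤ v_p(h(K^σ))`** (`K^σ = ℚ(x(P))`, `[K : K^σ] ∣ 2`). Then statement (A) holds for `W` at `p` over the cyclotomic
`ℤ_p`-extension (`∃ γ D, D.X` finitely generated over `ℤ_p`). Proof: §1 discharges the eigen-test of conjA-anchor g17's
`CoatesSujatha2005.conjA_of_eigenHom_subfield` (`a = p − 1`). The case `p ∤ h(K)` is p690512's `conjA_of_not_dvd_classNumber_stabilizerField`.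
[cite: CoatesSujatha2005, §3 Thm. 3.4 and Lemma 3.8] [cite: DeoRaySujatha2023, §3 Thm. 3.8 (c2) (arXiv:2202.09937 p. 9)]
[cite: NeukirchANT1999, Ch. III §1 Prop. (1.6) (ii), (iv)] -/
theorem conjA_of_relClassNumber (W : WeierstrassCurve ℚ) [W.IsElliptic] [NeZero p] (hp2 : p ≠ 2)
    (hirr : W.HasIrreducibleModPGaloisRep p)
    (hG : ¬ p ∣ Nat.card (W.divisionField p ≃ₐ[ℚ] W.divisionField p))
    (hP : haveI : NumberField (W.divisionField p) := NumberField.mk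
      ∃ P : geomTorsion W (p : ℤ), P ≠ 0 ∧ ∃ τ : absoluteGaloisGroup ℚ, τ • P = -P ∧
        ∀ K : IntermediateField ℚ (W.divisionField p),
          K = IntermediateField.fixedField
            ((MulAction.stabilizer (absoluteGaloisGroup ℚ) P).map (absRestrictNormalHom (W.divisionField p))) →
        ∀ σ : K ≃ₐ[ℚ] K,
          (∀ x : K, absRestrictNormalHom (W.divisionField p) τ (x : W.divisionField p) =
            ((σ x : K) : W.divisionField p)) →
          padicValNat p (NumberField.classNumber K) ≤
            padicValNat p (NumberField.classNumber (IntermediateField.fixedField (Subgroup.zpowers σ))))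
    {κ : ZpExtension ℚ p} (hκ : κ.IsCyclotomic)
    (hc3 : ∀ v : HeightOneSpectrum (𝓞 ℚ), ((p : ℕ) : 𝓞 ℚ) ∈ v.asIdeal →
      ∀ x : W.geomPrimaryTorsion p, p • x = 0 → (∀ d ∈ decomp v, d • x = x) → x = 0) :
    ∃ (γ : absoluteGaloisGroup ℚ) (D : W.FineSelmerDualData κ γ),
      Module.Finite ℤ_[p] (RestrictScalars ℤ_[p] (IwasawaAlgebra p) D.X) := by
  haveI : NumberField (W.divisionField p) := NumberField.mk
  obtain ⟨P, hP0, τ, hτ, hK⟩ := hP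
  set K : IntermediateField ℚ (W.divisionField p) := IntermediateField.fixedField
    ((MulAction.stabilizer (absoluteGaloisGroup ℚ) P).map (absRestrictNormalHom (W.divisionField p))) with hKdef
  obtain ⟨σ, hσ, hσ2⟩ := exists_algEquiv_stabilizerField_of_smul_eq_neg p W P τ hτ K hKdef
  have hh := hK K hKdef σ hσ
  refine conjA_of_eigenHom_subfield W hp2 hirr hG K P hP0 ?_ ?_ hκ hc3
  · -- `Γ_{ℚ(P)}` fixes `P` (as in p690512)
    intro τ' hτ'
    have hmem : absRestrictNormalHom (W.divisionField p) τ' ∈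
        (MulAction.stabilizer (absoluteGaloisGroup ℚ) P).map (absRestrictNormalHom (W.divisionField p)) := by
      rw [← IntermediateField.fixingSubgroup_fixedField
        ((MulAction.stabilizer (absoluteGaloisGroup ℚ) P).map (absRestrictNormalHom (W.divisionField p))),
        IntermediateField.mem_fixingSubgroup_iff]
      intro x hx
      exact hτ' ⟨x, hx⟩
    obtain ⟨τ₀, hτ₀, hres⟩ := Subgroup.mem_map.mp hmem
    have h1 : absRestrictNormalHom (W.divisionField p) (τ₀⁻¹ * τ') = 1 := by
      rw [map_mul, map_inv, hres, inv_mul_cancel]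
    have h2 := (W.absRestrictNormalHom_divisionField_eq_one_iff p (τ₀⁻¹ * τ')).mp h1 P
    rw [mul_smul, inv_smul_eq_iff] at h2
    rw [h2]; exact hτ₀
  · -- the eigen-test: §1 with `K⁺ = K^σ`, `a = p − 1`
    intro μ hrel
    set Kp : IntermediateField ℚ K := IntermediateField.fixedField (Subgroup.zpowers σ) with hKp
    have hfix : ∀ x : Kp, σ (x : K) = x := fun x =>
      (IntermediateField.mem_fixedField_iff (Subgroup.zpowers σ) (x : K)).mp x.2 σ (Subgroup.mem_zpowers σ)
    have hσsq : σ ^ 2 = 1 := by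
      ext x
      rw [pow_two, AlgEquiv.mul_apply, AlgEquiv.one_apply, hσ2]
    have hd : ¬ p ∣ Module.finrank Kp K := by
      rw [hKp, IntermediateField.finrank_fixedField_eq_card, Nat.card_zpowers]
      intro h
      have h2 : p ∣ 2 := h.trans (orderOf_dvd_of_pow_eq_one hσsq)
      exact hp2 ((Nat.prime_dvd_prime_iff_eq hp.out Nat.prime_two).mp h2)
    have hτa : τ • P = (p - 1) • P := by rw [hτ, pred_nsmul_eq_neg p W P]
    exact tautEigenHom_eq_zero_of_padicValNat_classNumber_le p K σ Kp hfix hd hh (p - 1)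
      (natCast_pred_ne_one p hp2) μ (hrel τ σ (p - 1) hσ hτa)


/-! ## §4 Door L6⁻ on the rows and on the partners of crux 19606 ((c1), (c3) and `τ` automatic) -/

section K8

open Summit.BirchSwinnertonDyer.BirchSwinnertonDyer.Theorems.EtaConjADoor

variable (V : WeierstrassCurve ℚ) [V.IsElliptic] [V.IsGloballyMinimal]

/-- **(A) on a ROW of crux 19606 from the relative class-number datum.** `V` globally minimal, `p ≥ 5` good, `a_p(V) = 0`, `p`-adic tower
not onto; datum: some `P ∈ V[p] ∖ 0` such that for every `τ` acting as `−1` on `P` (one exists in the inertia at `p`), `K = ℚ(P)` and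
`σ = τ|_K`: `v_p(h(K)) ≤ v_p(h(K^σ))`. No named fact. [cite: CoatesSujatha2005, §3 Thm. 3.4 and Lemma 3.8]
[cite: DeoRaySujatha2023, §3 Thm. 3.8 (c1)–(c3) (arXiv:2202.09937 p. 9)] [cite: Serre1972, §1.11 Prop. 12] -/
theorem conjA_row_of_relClassNumber [NeZero p] (hp5 : 5 ≤ p) (hgood : V.HasGoodReductionAtPrime p)
    (hap : V.frobeniusTrace p = 0) (hns : ¬ ∀ m : ℕ, V.HasSurjectiveModNGaloisRep (p ^ m : ℕ))
    (hP : haveI : NumberField (V.divisionField p) := NumberField.mk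
      ∃ P : geomTorsion V (p : ℤ), P ≠ 0 ∧ ∀ τ : absoluteGaloisGroup ℚ, τ • P = -P →
        ∀ K : IntermediateField ℚ (V.divisionField p),
          K = IntermediateField.fixedField
            ((MulAction.stabilizer (absoluteGaloisGroup ℚ) P).map (absRestrictNormalHom (V.divisionField p))) →
        ∀ σ : K ≃ₐ[ℚ] K,
          (∀ x : K, absRestrictNormalHom (V.divisionField p) τ (x : V.divisionField p) =
            ((σ x : K) : V.divisionField p)) →
          padicValNat p (NumberField.classNumber K) ≤
            padicValNat p (NumberField.classNumber (IntermediateField.fixedField (Subgroup.zpowers σ))))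
    (κ : ZpExtension ℚ p) (hκ : κ.IsCyclotomic) :
    ∃ (γ : absoluteGaloisGroup ℚ) (D : V.FineSelmerDualData κ γ),
      Module.Finite ℤ_[p] (RestrictScalars ℤ_[p] (IwasawaAlgebra p) D.X) := by
  haveI : NumberField (V.divisionField p) := NumberField.mk
  obtain ⟨P, hP0, h⟩ := hP
  obtain ⟨z, -, hz⟩ := exists_mem_inertia_smul_eq_neg_of_goodSS (W := V) (p := p) (by omega)
    (goodSS_of_row V p hgood hap) (natCast_mem_asIdeal_iff_eq_primesEquiv_symm _ hp.out |>.mpr rfl)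
    (adicCompletionPrime_mem_primesAbove ℚ (primesEquiv.symm ⟨p, hp.out⟩))
  exact conjA_of_relClassNumber p V (by omega) (irreducible_of_row V p hp5 hgood hap)
    (not_dvd_card_aut_divisionField_of_row V p hp5 hgood hap hns) ⟨P, hP0, z, hz P, h z (hz P)⟩ hκ
    (fun v hv x hpx hx => geomPrimaryTorsion_fixed_eq_zero_of_row V p hp5 hgood hap v hv x hpx hx)

variable (W : WeierstrassCurve ℚ) [W.IsElliptic] (C : VariableChange ℚ)

/-- **(A) on the PARTNER `W` of a row of crux 19606 (`C • W^{(p*)} = V`) from the relative class-number datum** — for one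
`P ∈ W[p] ∖ 0` and every `τ` acting as `−1` on `P` (one exists: p690512 `exists_mem_inertia_smul_eq_neg_pair`): `v_p h(ℚ(P)) ≤ v_p h(ℚ(P)^σ)`,
`ℚ(P)^σ = ℚ(x(P))` (`[ℚ(P):ℚ(x(P))] = 2`; at `p = 5`: degrees `24` / `12`). No named fact. This is the conclusion of v7's
`stub_conjA_partners_cm` (and v5's `stub_conjA_partners`) AT THE ROW. [cite: CoatesSujatha2005, §3 Thm. 3.4 and Lemma 3.8]
[cite: DeoRaySujatha2023, §3 Thm. 3.8 (c1)–(c3) (arXiv:2202.09937 p. 9)] [cite: SilvermanAEC2009, X.5 Cor. 5.4] -/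
theorem conjA_partner_of_relClassNumber [NeZero p] (hp5 : 5 ≤ p) (hC : C • W.quadraticTwist ((-1) ^ (p / 2) * p) = V)
    (hgood : V.HasGoodReductionAtPrime p) (hap : V.frobeniusTrace p = 0)
    (hns : ¬ ∀ m : ℕ, V.HasSurjectiveModNGaloisRep (p ^ m : ℕ))
    (hP : haveI : NumberField (W.divisionField p) := NumberField.mk
      ∃ P : geomTorsion W (p : ℤ), P ≠ 0 ∧ ∀ τ : absoluteGaloisGroup ℚ, τ • P = -P →
        ∀ K : IntermediateField ℚ (W.divisionField p),
          K = IntermediateField.fixedField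
            ((MulAction.stabilizer (absoluteGaloisGroup ℚ) P).map (absRestrictNormalHom (W.divisionField p))) →
        ∀ σ : K ≃ₐ[ℚ] K,
          (∀ x : K, absRestrictNormalHom (W.divisionField p) τ (x : W.divisionField p) =
            ((σ x : K) : W.divisionField p)) →
          padicValNat p (NumberField.classNumber K) ≤
            padicValNat p (NumberField.classNumber (IntermediateField.fixedField (Subgroup.zpowers σ))))
    (κ : ZpExtension ℚ p) (hκ : κ.IsCyclotomic) :
    ∃ (γ : absoluteGaloisGroup ℚ) (D : W.FineSelmerDualData κ γ),
      Module.Finite ℤ_[p] (RestrictScalars ℤ_[p] (IwasawaAlgebra p) D.X) := by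
  haveI : NumberField (W.divisionField p) := NumberField.mk
  obtain ⟨P, hP0, h⟩ := hP
  obtain ⟨z, -, hzW, -⟩ := exists_mem_inertia_smul_eq_neg_pair V p W C hp5 hgood hap hC
    (natCast_mem_asIdeal_iff_eq_primesEquiv_symm _ hp.out |>.mpr rfl)
    (adicCompletionPrime_mem_primesAbove ℚ (primesEquiv.symm ⟨p, hp.out⟩))
  exact conjA_of_relClassNumber p W (by omega) (irreducible_partner V p W C hp5 hgood hap hC)
    (not_dvd_card_aut_divisionField_partner V p W C hp5 hgood hap hns hC) ⟨P, hP0, z, hzW P, h z (hzW P)⟩ hκ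
    (fun v hv x hpx hx => geomPrimaryTorsion_fixed_eq_zero_partner V p W C hp5 hgood hap hC v hv x hpx hx)

end K8

end Summit.BirchSwinnertonDyer.BirchSwinnertonDyer.Theorems.EtaConjADoorMinus

end
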